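import Mathlib
import Summits.KontsevichZagierPeriods.Zeta5Search.ClusterValuation
import Summits.KontsevichZagierPeriods.Zeta5Search.PalindromicClassBounds
import Summits.KontsevichZagierPeriods.Zeta5Search.DenomLaw.ThresholdModelBridgeClassExp
import Summits.KontsevichZagierPeriods.Zeta5Search.DenomLaw.ThresholdModelConfigNet

/-!
# ζ(5) search — DENOM-LAW: the threshold model, PART IV (the level configuration of a dominant class), part C: positions by level and the tree's `classConfig`

Cell `pub-zeta5`, track DENOM-LAW (K1 typing order item (1), «ThresholdModel port»): denom-engine-d2 g14's kernel-checked scratch module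
`denom-law/engine-d2/g14/lean/LevelCensusConfig.lean` PART IV (THRESHOLD-X6) filed VERBATIM in four parts (≤ 400 lines each; docstrings added
where the scratch file had none) by denom-prover-d1 g5.  Part C of 4.
HONEST FRAMING: systematic search; MODEL/structure side — the level configuration of a dominant class identified with the tree's `classConfig`/`IsPalindromic` and the rung-M/K coefficient rows in closed form; nothing about ζ(5); no γ; no irrationality claim; records in print UNMOVED.
The mathematical header of PART IV is the second module docstring of part A (`ThresholdModelConfig.lean`).
-/

namespace Summit.KontsevichZagierPeriods.Zeta5Search.DenomLaw.ThresholdModel.Rho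

section Config

open Summit.KontsevichZagierPeriods.Zeta5Search.ClusterValuation
  (blockCount netExp classSet classExp CentreIn classPoleCount HasPoleOfOrder classConfig IsPalindromic classBound
    GoodClasses)

/-! ### (X6-2) the tree side: positions of a dominant class by level, and the CONFIGURATION -/

section Tree
variable {b : ℕ → ℤ} {p : ℕ} {m u : ℤ}

/-- a residue BELOW `p` for every class (as Part III's `exists_residue`, keeping `x < p` — the range of `GoodClasses`). -/
theorem exists_residue_lt {p m b0 : ℤ} (hp : 1 ≤ p) (u : ℤ) :
    ∃ x : ℕ, (x : ℤ) < p ∧ p ∣ (x : ℤ) + 1 - tOf p m b0 0 u := by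
  set t0 := tOf p m b0 0 u with ht0
  have h0 : 0 ≤ (t0 - 1) % p := Int.emod_nonneg _ (by linarith)
  have h1 : (t0 - 1) % p < p := Int.emod_lt_of_pos _ (by linarith)
  have hdm := Int.mul_ediv_add_emod (t0 - 1) p
  refine ⟨((t0 - 1) % p).toNat, ?_, ⟨-((t0 - 1) / p), ?_⟩⟩
  · rw [Int.toNat_of_nonneg h0]; exact h1
  · rw [Int.toNat_of_nonneg h0]; linarith

/-- **CLASS MEMBERSHIP BY LEVEL**: `s ∈ classSet b p x ⟺ s + 1 = t(ℓ,u)` for a NUMERATOR level `ℓ` of the class offset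
`u` of `x` (the two halves of Part III's re-indexing `sum_classSet_eq_sum_levels`, as a membership criterion). -/
theorem mem_classSet_iff (h : LevelBox (p : ℤ) (R0b p m (b 0)) (rhob p m (b 0) (lowerB b))) (hm : 1 ≤ m)
    (hc : (u - R0b (p : ℤ) m (b 0)) % 2 = 0) {x : ℕ} (hx : (p : ℤ) ∣ (x : ℤ) + 1 - tOf p m (b 0) 0 u) (s : ℕ) :
    s ∈ classSet b p x ↔ ∃ ℓ, NumCov (p : ℤ) m (R0b p m (b 0)) ℓ u ∧ (s : ℤ) + 1 = tOf p m (b 0) ℓ u := by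
  have hb0 := lbox_b0_nonneg h hm
  simp only [classSet, Finset.mem_filter, Finset.mem_range]
  constructor
  · rintro ⟨hs1, hs2⟩
    have hdvd : (p : ℤ) ∣ (x : ℤ) - s := Nat.modEq_iff_dvd.1 (hs2 : Nat.ModEq p s x)
    have hdvd' : (p : ℤ) ∣ ((s : ℤ) + 1) - tOf (p : ℤ) m (b 0) 0 u := by
      have := dvd_sub hx hdvd
      have e : (x : ℤ) + 1 - tOf (p : ℤ) m (b 0) 0 u - ((x : ℤ) - s) = (s : ℤ) + 1 - tOf (p : ℤ) m (b 0) 0 u := by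
        ring
      rwa [e] at this
    obtain ⟨ℓ, hℓ⟩ := exists_level_of_dvd hc hdvd'
    exact ⟨ℓ, (tOf_mem_num_iff hc).1 ⟨by omega, by omega⟩, hℓ.symm⟩
  · rintro ⟨ℓ, hN, hs⟩
    obtain ⟨h1, h2⟩ := (tOf_mem_num_iff hc).2 hN
    have e := tOf_eq_tOf_zero_add hc ℓ
    refine ⟨by omega, ?_⟩
    refine (Nat.modEq_iff_dvd.2 ?_ : Nat.ModEq p s x)
    obtain ⟨c, hcx⟩ := hx
    exact ⟨c - ℓ, by linear_combination hcx - hs - e⟩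

/-- **POSITION ↦ LEVEL along a dominant class**: a position `q` of the tree's class of `x` is `t(ℓ,u) − 1` for a level
`−n₋ ≤ ℓ ≤ 3m − 2 + n₊`, and there `netExp b q = domNetExp(ℓ,u)` (Part III's `netExp_eq` + `netE_of_dominant`). -/
theorem level_of_pos (hB : BCell (p : ℤ) ((m - 1) * p) (b 0) (lowerB b)) (hm : 1 ≤ m)
    (hd : IsDominant (p : ℤ) (R0b p m (b 0)) (rhob p m (b 0) (lowerB b)) u) {x : ℕ}
    (hx : (p : ℤ) ∣ (x : ℤ) + 1 - tOf p m (b 0) 0 u) {q : ℕ} (hq : q ∈ classSet b p x) :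
    ∃ ℓ, -nm (p : ℤ) (R0b p m (b 0)) u ≤ ℓ ∧ ℓ ≤ 3 * m - 2 + np (p : ℤ) (R0b p m (b 0)) u ∧
      (q : ℤ) + 1 = tOf p m (b 0) ℓ u ∧ netExp b q = domNetExp (p : ℤ) (R0b p m (b 0)) m (rhob p m (b 0) (lowerB b)) ℓ u := by
  have hD : DeepCell (p : ℤ) (R0b p m (b 0)) (rhob p m (b 0) (lowerB b)) := by
    rw [rhob_eq_rhoOf, R0b_eq_R0Of]; exact hB.deepCell
  have h := hD.levelBox
  have hc := hd.1.2.2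
  obtain ⟨ℓ, hN, hqℓ⟩ := (mem_classSet_iff h hm hc hx q).1 hq
  obtain ⟨hlo, hhi⟩ := (hD.numCov_iff_of_dominant hd hm ℓ).1 hN
  have hqb : (q : ℤ) ≤ b 0 := by obtain ⟨-, h2⟩ := (tOf_mem_num_iff hc).2 hN; omega
  refine ⟨ℓ, hlo, hhi, hqℓ, ?_⟩
  rw [netExp_eq h hm hc hqℓ hqb, hD.netE_of_dominant hd hm ℓ]

/-- **LEVEL ↦ POSITION along a dominant class**: every level `−n₋ ≤ ℓ ≤ 3m − 2 + n₊` gives the position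
`q = t(ℓ,u) − 1 ∈ classSet b p x`, with `netExp b q = domNetExp(ℓ,u)`. -/
theorem pos_of_level (hB : BCell (p : ℤ) ((m - 1) * p) (b 0) (lowerB b)) (hm : 1 ≤ m)
    (hd : IsDominant (p : ℤ) (R0b p m (b 0)) (rhob p m (b 0) (lowerB b)) u) {x : ℕ}
    (hx : (p : ℤ) ∣ (x : ℤ) + 1 - tOf p m (b 0) 0 u) {ℓ : ℤ}
    (hlo : -nm (p : ℤ) (R0b p m (b 0)) u ≤ ℓ) (hhi : ℓ ≤ 3 * m - 2 + np (p : ℤ) (R0b p m (b 0)) u) :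
    ∃ q ∈ classSet b p x, (q : ℤ) + 1 = tOf p m (b 0) ℓ u ∧
      netExp b q = domNetExp (p : ℤ) (R0b p m (b 0)) m (rhob p m (b 0) (lowerB b)) ℓ u := by
  have hD : DeepCell (p : ℤ) (R0b p m (b 0)) (rhob p m (b 0) (lowerB b)) := by
    rw [rhob_eq_rhoOf, R0b_eq_R0Of]; exact hB.deepCell
  have h := hD.levelBox
  have hc := hd.1.2.2
  have hN := (hD.numCov_iff_of_dominant hd hm ℓ).2 ⟨hlo, hhi⟩
  obtain ⟨h1, h2⟩ := (tOf_mem_num_iff hc).2 hN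
  have hsℓ : (((tOf (p : ℤ) m (b 0) ℓ u - 1).toNat : ℕ) : ℤ) + 1 = tOf (p : ℤ) m (b 0) ℓ u := by
    rw [Int.toNat_of_nonneg (by linarith)]; ring
  refine ⟨(tOf (p : ℤ) m (b 0) ℓ u - 1).toNat, (mem_classSet_iff h hm hc hx _).2 ⟨ℓ, hN, hsℓ⟩, hsℓ, ?_⟩
  rw [netExp_eq h hm hc hsℓ (by rw [Int.toNat_of_nonneg (by linarith)]; linarith), hD.netE_of_dominant hd hm ℓ]

/-- the tree's odd-centre condition `b₀ odd ∧ CentreIn b p x` along a dominant class: exactly `u = 0` at odd `m`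
(`b0_odd_iff`, `centreIn_iff`, and `u ≠ p`). -/
theorem oddCentre_iff_of_dominant (hB : BCell (p : ℤ) ((m - 1) * p) (b 0) (lowerB b)) (hm : 1 ≤ m)
    (hd : IsDominant (p : ℤ) (R0b p m (b 0)) (rhob p m (b 0) (lowerB b)) u) {x : ℕ}
    (hx : (p : ℤ) ∣ (x : ℤ) + 1 - tOf p m (b 0) 0 u) :
    (¬ (2 : ℤ) ∣ b 0 ∧ CentreIn b p x) ↔ (u = 0 ∧ m % 2 = 1) := by
  have hD : DeepCell (p : ℤ) (R0b p m (b 0)) (rhob p m (b 0) (lowerB b)) := by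
    rw [rhob_eq_rhoOf, R0b_eq_R0Of]; exact hB.deepCell
  have h := hD.levelBox
  have _hm := hm
  have hc := hd.1.2.2
  have hup := hD.lt_p_of_dominant hd
  rw [b0_odd_iff hB.odd_p hc, centreIn_iff h hc hd.1.1 hd.1.2.1 hx]
  constructor
  · rintro ⟨h1, h2 | h2⟩
    · exact ⟨h2, by omega⟩
    · exfalso; linarith
  · rintro ⟨h1, h2⟩; exact ⟨by omega, Or.inl h1⟩

/-- **THE CONFIGURATION OF A DOMINANT CLASS, BY LEVELS** — membership in the tree's `classConfig b p x` (the datum of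
Theorem B's palindrome test): the pairs `(b₀ + d(ℓ,u), domNetExp(ℓ,u))` over the numerator levels `−n₋ ≤ ℓ ≤ 3m−2+n₊`
(doubled positions `2q = b₀ + d(ℓ,u)`; no such level is neutral), plus the odd centre `(b₀, 1)` exactly for the centre
class `u = 0` at odd `m`. -/
theorem mem_classConfig_iff (hB : BCell (p : ℤ) ((m - 1) * p) (b 0) (lowerB b)) (hm : 1 ≤ m)
    (hd : IsDominant (p : ℤ) (R0b p m (b 0)) (rhob p m (b 0) (lowerB b)) u) {x : ℕ}
    (hx : (p : ℤ) ∣ (x : ℤ) + 1 - tOf p m (b 0) 0 u) (P e : ℤ) :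
    (P, e) ∈ classConfig b p x ↔
      (∃ ℓ, -nm (p : ℤ) (R0b p m (b 0)) u ≤ ℓ ∧ ℓ ≤ 3 * m - 2 + np (p : ℤ) (R0b p m (b 0)) u ∧
          P = b 0 + dpos (p : ℤ) m ℓ u ∧ e = domNetExp (p : ℤ) (R0b p m (b 0)) m (rhob p m (b 0) (lowerB b)) ℓ u) ∨
      (u = 0 ∧ m % 2 = 1 ∧ P = b 0 ∧ e = 1) := by
  have hD : DeepCell (p : ℤ) (R0b p m (b 0)) (rhob p m (b 0) (lowerB b)) := by
    rw [rhob_eq_rhoOf, R0b_eq_R0Of]; exact hB.deepCell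
  have hc := hd.1.2.2
  have hodd := oddCentre_iff_of_dominant hB hm hd hx
  unfold classConfig
  rw [Finset.mem_union, Finset.mem_image]
  constructor
  · rintro (⟨s, hs, hse⟩ | hmem)
    · left
      rw [Finset.mem_filter] at hs
      obtain ⟨hs, -⟩ := hs
      obtain ⟨ℓ, hlo, hhi, hsℓ, hnet⟩ := level_of_pos hB hm hd hx hs
      have h2 := two_mul_tOf hc ℓ
      simp only [Prod.mk.injEq] at hse
      obtain ⟨hP, hE⟩ := hse
      refine ⟨ℓ, hlo, hhi, ?_, by rw [← hE, hnet]⟩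
      rw [← hP]; push_cast; omega
    · right
      split_ifs at hmem with hcond
      · rw [Finset.mem_singleton, Prod.mk.injEq] at hmem
        exact ⟨(hodd.1 hcond).1, (hodd.1 hcond).2, hmem.1, hmem.2⟩
      · simp at hmem
  · rintro (⟨ℓ, hlo, hhi, hP, hE⟩ | ⟨h0, hmo, hP, hE⟩)
    · left
      obtain ⟨q, hq, hqℓ, hnet⟩ := pos_of_level hB hm hd hx hlo hhi
      have h2 := two_mul_tOf hc ℓ
      refine ⟨q, Finset.mem_filter.2 ⟨hq, ?_⟩, ?_⟩
      · rw [hnet]; exact hD.domNetExp_ne_zero hd hm hlo hhi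
      · simp only [Prod.mk.injEq]
        refine ⟨?_, by rw [hE, hnet]⟩
        rw [hP]; push_cast; omega
    · right
      rw [if_pos (hodd.2 ⟨h0, hmo⟩), Finset.mem_singleton, hP, hE]

/-! ### (X6-3) the PALINDROME CRITERION and the class bound of a dominant class -/

/-- **THE PALINDROME CRITERION FOR A DOMINANT CLASS**: the level configuration of a dominant class of a deep cell is
palindromic — Theorem B's bonus test `IsPalindromic (classConfig b p x)` — iff its root type is MIRROR-SYMMETRIC:
`L(u) = R(u)` and `n₊(u) = n₋(u)`.  (The reflection is `ℓ ↦ 3m − 2 − ℓ`, i.e. `P ↦ 2b₀ − 2u − P` on doubled positions;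
it fixes the merged / odd centre exactly when `u = 0`, and a dominant class has `u ≠ p`.) -/
theorem isPalindromic_iff_of_dominant (hB : BCell (p : ℤ) ((m - 1) * p) (b 0) (lowerB b)) (hm : 1 ≤ m)
    (hd : IsDominant (p : ℤ) (R0b p m (b 0)) (rhob p m (b 0) (lowerB b)) u) {x : ℕ}
    (hx : (p : ℤ) ∣ (x : ℤ) + 1 - tOf p m (b 0) 0 u) :
    IsPalindromic (classConfig b p x) ↔
      (L (p : ℤ) (rhob p m (b 0) (lowerB b)) u = R (p : ℤ) (rhob p m (b 0) (lowerB b)) u ∧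
        np (p : ℤ) (R0b p m (b 0)) u = nm (p : ℤ) (R0b p m (b 0)) u) := by
  have hD : DeepCell (p : ℤ) (R0b p m (b 0)) (rhob p m (b 0) (lowerB b)) := by
    rw [rhob_eq_rhoOf, R0b_eq_R0Of]; exact hB.deepCell
  exact hD.isPalindromic_iff_levels hd hm (b 0) _ (fun P e => mem_classConfig_iff hB hm hd hx P e)

/-- in particular the CENTRE CLASS `u = 0`, when dominant, is ALWAYS palindromic (`L(0) = R(0)`, `n₊(0) = n₋(0)`). -/
theorem isPalindromic_of_dominant_zero (hB : BCell (p : ℤ) ((m - 1) * p) (b 0) (lowerB b)) (hm : 1 ≤ m)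
    (hd : IsDominant (p : ℤ) (R0b p m (b 0)) (rhob p m (b 0) (lowerB b)) 0) {x : ℕ}
    (hx : (p : ℤ) ∣ (x : ℤ) + 1 - tOf p m (b 0) 0 0) : IsPalindromic (classConfig b p x) := by
  refine (isPalindromic_iff_of_dominant hB hm hd hx).2 ⟨?_, ?_⟩
  · unfold L R; rw [zero_add, sub_zero]
  · unfold np nm; exact indic_congr ⟨fun h => by linarith, fun h => by linarith⟩

/-- **`classBound` OF A DOMINANT CLASS** (g6/g7's `T_x(s)` with the palindrome bonus; always the `≥ 2`-pole branch since
`classPoleCount = m + 1`): `T_x(s) = s + E_x + [L = R ∧ n₊ = n₋ ∧ s + E_x odd]`. -/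
theorem classBound_of_dominant (hB : BCell (p : ℤ) ((m - 1) * p) (b 0) (lowerB b)) (hm : 1 ≤ m)
    (hd : IsDominant (p : ℤ) (R0b p m (b 0)) (rhob p m (b 0) (lowerB b)) u) {x : ℕ}
    (hx : (p : ℤ) ∣ (x : ℤ) + 1 - tOf p m (b 0) 0 u) (s : ℕ) :
    classBound b p x s = (s : ℤ) + classExp b p x +
      indic (L (p : ℤ) (rhob p m (b 0) (lowerB b)) u = R (p : ℤ) (rhob p m (b 0) (lowerB b)) u ∧
        np (p : ℤ) (R0b p m (b 0)) u = nm (p : ℤ) (R0b p m (b 0)) u ∧ Odd ((s : ℤ) + classExp b p x)) := by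
  have key := isPalindromic_iff_of_dominant hB hm hd hx
  have h2 : 2 ≤ classPoleCount b p x := by have := classPoleCount_of_dominant hB hm hd hx; omega
  unfold classBound
  rw [if_pos h2]
  by_cases hc : IsPalindromic (classConfig b p x) ∧ Odd ((s : ℤ) + classExp b p x)
  · rw [if_pos hc, indic_pos ⟨(key.1 hc.1).1, (key.1 hc.1).2, hc.2⟩]
  · rw [if_neg hc, indic_neg (fun h' => hc ⟨key.2 ⟨h'.1, h'.2.1⟩, h'.2.2⟩)]

/-- … and for ODD `s` (`s = 3`: the ζ(3)-coefficient `W`; `s = 5`: `U`) explicitly: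
    `T_x(s) = s + δ(u) + [u = 0] − (4m + 8) + [u ≠ 0 ∧ L(u) = R(u) ∧ n₊(u) = n₋(u)]`
— the PALINDROME BONUS (the accounting rung "K" of census g13) fires on a dominant class of a deep cell EXACTLY on the
mirror-symmetric root types OFF the centre class: on `u = 0` the configuration is palindromic but `s + E_x` is even
(`δ(0) = 2L + 2n₊`, centre unit `1`), elsewhere `δ = 2L + 2n₊` is even and `s + E_x` odd. -/
theorem classBound_of_dominant_odd (hB : BCell (p : ℤ) ((m - 1) * p) (b 0) (lowerB b)) (hm : 1 ≤ m)
    (hd : IsDominant (p : ℤ) (R0b p m (b 0)) (rhob p m (b 0) (lowerB b)) u) {x : ℕ}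
    (hx : (p : ℤ) ∣ (x : ℤ) + 1 - tOf p m (b 0) 0 u) {s : ℕ} (hs : Odd s) :
    classBound b p x s = (s : ℤ) + delta (p : ℤ) (R0b p m (b 0)) (rhob p m (b 0) (lowerB b)) u + indic (u = 0)
      - (4 * m + 8) +
      indic (u ≠ 0 ∧ L (p : ℤ) (rhob p m (b 0) (lowerB b)) u = R (p : ℤ) (rhob p m (b 0) (lowerB b)) u ∧
        np (p : ℤ) (R0b p m (b 0)) u = nm (p : ℤ) (R0b p m (b 0)) u) := by
  have hD : DeepCell (p : ℤ) (R0b p m (b 0)) (rhob p m (b 0) (lowerB b)) := by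
    rw [rhob_eq_rhoOf, R0b_eq_R0Of]; exact hB.deepCell
  have h := hD.levelBox
  have hup := hD.lt_p_of_dominant hd
  have hs' : (s : ℤ) % 2 = 1 := by have := Nat.odd_iff.1 hs; omega
  -- E_x = δ + [u = 0] − (4m+8) on a dominant class (`classExp_eq`, `δ_A = δ`, `u ≠ p`)
  have hE : classExp b p x =
      delta (p : ℤ) (R0b p m (b 0)) (rhob p m (b 0) (lowerB b)) u + indic (u = 0) - (4 * m + 8) := by
    obtain ⟨a1, a2, a3, a4⟩ := hD.dominant_admissible hd
    rw [classExp_eq h hm hB.odd_p hd.1.2.2 hd.1.1 hd.1.2.1 hx]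
    unfold scoreA centre
    rw [DeepCell.deltaA_eq_delta a1 a2 a4 a3,
      indic_congr (show (u = 0 ∨ u = (p : ℤ)) ↔ u = 0 from ⟨fun h' => h'.resolve_right (by omega), Or.inl⟩)]
  rw [classBound_of_dominant hB hm hd hx s, hE]
  have key : (L (p : ℤ) (rhob p m (b 0) (lowerB b)) u = R (p : ℤ) (rhob p m (b 0) (lowerB b)) u ∧
        np (p : ℤ) (R0b p m (b 0)) u = nm (p : ℤ) (R0b p m (b 0)) u ∧
        Odd ((s : ℤ) + (delta (p : ℤ) (R0b p m (b 0)) (rhob p m (b 0) (lowerB b)) u + indic (u = 0) - (4 * m + 8)))) ↔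
      (u ≠ 0 ∧ L (p : ℤ) (rhob p m (b 0) (lowerB b)) u = R (p : ℤ) (rhob p m (b 0) (lowerB b)) u ∧
        np (p : ℤ) (R0b p m (b 0)) u = nm (p : ℤ) (R0b p m (b 0)) u) := by
    constructor
    · rintro ⟨h1, h2, h3⟩
      refine ⟨fun h0 => ?_, h1, h2⟩
      rw [Int.odd_iff, indic_pos h0] at h3
      unfold delta at h3
      omega
    · rintro ⟨h0, h1, h2⟩
      refine ⟨h1, h2, ?_⟩
      rw [Int.odd_iff, indic_neg h0]
      unfold delta
      omega
  rw [indic_congr key]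
  ring

/-- on the CENTRE class (`u = 0`; odd `s`): `T_x(s) = s + δ(0) + 1 − (4m + 8)` — palindromic, but never a bonus. -/
theorem classBound_of_dominant_zero_odd (hB : BCell (p : ℤ) ((m - 1) * p) (b 0) (lowerB b)) (hm : 1 ≤ m)
    (hd : IsDominant (p : ℤ) (R0b p m (b 0)) (rhob p m (b 0) (lowerB b)) 0) {x : ℕ}
    (hx : (p : ℤ) ∣ (x : ℤ) + 1 - tOf p m (b 0) 0 0) {s : ℕ} (hs : Odd s) :
    classBound b p x s = (s : ℤ) + delta (p : ℤ) (R0b p m (b 0)) (rhob p m (b 0) (lowerB b)) 0 + 1 - (4 * m + 8) := by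
  rw [classBound_of_dominant_odd hB hm hd hx hs, indic_pos rfl, indic_neg (fun h' => h'.1 rfl)]
  ring

/-- OFF the centre class (`u ≠ 0`; odd `s`): `T_x(s) = s + δ(u) − (4m + 8) + [L(u) = R(u) ∧ n₊(u) = n₋(u)]`. -/
theorem classBound_of_dominant_ne_zero_odd (hB : BCell (p : ℤ) ((m - 1) * p) (b 0) (lowerB b)) (hm : 1 ≤ m)
    (hd : IsDominant (p : ℤ) (R0b p m (b 0)) (rhob p m (b 0) (lowerB b)) u) {x : ℕ}
    (hx : (p : ℤ) ∣ (x : ℤ) + 1 - tOf p m (b 0) 0 u) {s : ℕ} (hs : Odd s) (hu : u ≠ 0) :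
    classBound b p x s = (s : ℤ) + delta (p : ℤ) (R0b p m (b 0)) (rhob p m (b 0) (lowerB b)) u - (4 * m + 8) +
      indic (L (p : ℤ) (rhob p m (b 0) (lowerB b)) u = R (p : ℤ) (rhob p m (b 0) (lowerB b)) u ∧
        np (p : ℤ) (R0b p m (b 0)) u = nm (p : ℤ) (R0b p m (b 0)) u) := by
  rw [classBound_of_dominant_odd hB hm hd hx hs, indic_neg hu,
    indic_congr (show (u ≠ 0 ∧ L (p : ℤ) (rhob p m (b 0) (lowerB b)) u = R (p : ℤ) (rhob p m (b 0) (lowerB b)) u ∧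
        np (p : ℤ) (R0b p m (b 0)) u = nm (p : ℤ) (R0b p m (b 0)) u) ↔
      (L (p : ℤ) (rhob p m (b 0) (lowerB b)) u = R (p : ℤ) (rhob p m (b 0) (lowerB b)) u ∧
        np (p : ℤ) (R0b p m (b 0)) u = nm (p : ℤ) (R0b p m (b 0)) u) from ⟨fun h' => h'.2, fun h' => ⟨hu, h'⟩⟩)]
  ring

/-! ### (X6-4) `HasPoleOfOrder` and `GoodClasses` on the D region -/

/-- **`HasPoleOfOrder` OF A DOMINANT CLASS**: the pole orders met along the class are `6 − L`, `6 − R` (the frame edges)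
and, for `m ≥ 2`, the interior order `6` — lowered to `5` at the merged even centre, which is the ONLY interior level
exactly when `m = 2` (then `d(2,u) = −u`, so it bites for the centre class `u = 0`).  Hence
`HasPoleOfOrder b p x s ⟺ s ≤ 6 − L ∨ s ≤ 6 − R ∨ (m ≥ 3 ∧ s ≤ 6) ∨ (m = 2 ∧ s ≤ 6 − [u = 0])`. -/
theorem hasPoleOfOrder_iff_of_dominant (hB : BCell (p : ℤ) ((m - 1) * p) (b 0) (lowerB b)) (hm : 1 ≤ m)
    (hd : IsDominant (p : ℤ) (R0b p m (b 0)) (rhob p m (b 0) (lowerB b)) u) {x : ℕ}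
    (hx : (p : ℤ) ∣ (x : ℤ) + 1 - tOf p m (b 0) 0 u) (s : ℕ) :
    HasPoleOfOrder b p x s ↔
      ((s : ℤ) ≤ 6 - L (p : ℤ) (rhob p m (b 0) (lowerB b)) u ∨ (s : ℤ) ≤ 6 - R (p : ℤ) (rhob p m (b 0) (lowerB b)) u ∨
        (3 ≤ m ∧ s ≤ 6) ∨ (m = 2 ∧ (s : ℤ) ≤ 6 - indic (u = 0))) := by
  have hD : DeepCell (p : ℤ) (R0b p m (b 0)) (rhob p m (b 0) (lowerB b)) := by
    rw [rhob_eq_rhoOf, R0b_eq_R0Of]; exact hB.deepCell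
  obtain ⟨hL4, hR4, -⟩ := hD.LRnn_le_four hd
  have hn0 : 0 ≤ nm (p : ℤ) (R0b p m (b 0)) u := indic_nonneg _
  have hn1 : nm (p : ℤ) (R0b p m (b 0)) u ≤ 1 := indic_le_one _
  have hN0 : 0 ≤ np (p : ℤ) (R0b p m (b 0)) u := indic_nonneg _
  have hN1 : np (p : ℤ) (R0b p m (b 0)) u ≤ 1 := indic_le_one _
  have hu1 := hd.1.1
  have hup := hD.lt_p_of_dominant hd
  have two : ∀ v : ℤ, (dpos (p : ℤ) 2 2 v = 0 ↔ v = 0) := fun v => by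
    unfold dpos; constructor <;> intro h0 <;> linarith
  unfold HasPoleOfOrder
  constructor
  · rintro ⟨q, hq, hle⟩
    obtain ⟨ℓ, hlo, hhi, -, hnet⟩ := level_of_pos hB hm hd hx hq
    rw [hnet] at hle
    rcases (show (ℓ = -1 ∧ nm (p : ℤ) (R0b p m (b 0)) u = 1) ∨ (0 ≤ ℓ ∧ ℓ ≤ m - 2) ∨ ℓ = m - 1 ∨
        (m ≤ ℓ ∧ ℓ ≤ 2 * m - 2) ∨ ℓ = 2 * m - 1 ∨ (2 * m ≤ ℓ ∧ ℓ ≤ 3 * m - 2) ∨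
        (ℓ = 3 * m - 1 ∧ np (p : ℤ) (R0b p m (b 0)) u = 1) by omega)
      with ⟨e, hn⟩ | ⟨h0, h1⟩ | e | ⟨h0, h1⟩ | e | ⟨h0, h1⟩ | ⟨e, hn⟩
    · rw [hD.domNetExp_eq_one hd hm (Or.inr (Or.inr (Or.inl ⟨e, hn⟩)))] at hle; omega
    · rw [hD.domNetExp_eq_one hd hm (Or.inl ⟨h0, h1⟩)] at hle; omega
    · subst e; rw [hD.domNetExp_lowEdge hd hm] at hle; exact Or.inl (by omega)
    · rw [domNetExp_interior h0 h1] at hle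
      have hi0 := indic_nonneg (dpos (p : ℤ) m ℓ u = 0)
      by_cases hm3 : 3 ≤ m
      · exact Or.inr (Or.inr (Or.inl ⟨hm3, by omega⟩))
      · have hm2 : m = 2 := by omega
        have hℓ2 : ℓ = 2 := by omega
        subst hm2 hℓ2
        rw [indic_congr (two u)] at hle
        exact Or.inr (Or.inr (Or.inr ⟨rfl, by omega⟩))
    · subst e; rw [hD.domNetExp_highEdge hd hm] at hle; exact Or.inr (Or.inl (by omega))
    · rw [hD.domNetExp_eq_one hd hm (Or.inr (Or.inl ⟨h0, h1⟩))] at hle; omega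
    · rw [hD.domNetExp_eq_one hd hm (Or.inr (Or.inr (Or.inr ⟨e, hn⟩)))] at hle; omega
  · rintro (h1 | h1 | ⟨h3, h1⟩ | ⟨h2, h1⟩)
    · obtain ⟨q, hq, -, hnet⟩ := pos_of_level hB hm hd hx (ℓ := m - 1) (by omega) (by omega)
      exact ⟨q, hq, by rw [hnet, hD.domNetExp_lowEdge hd hm]; omega⟩
    · obtain ⟨q, hq, -, hnet⟩ := pos_of_level hB hm hd hx (ℓ := 2 * m - 1) (by omega) (by omega)
      exact ⟨q, hq, by rw [hnet, hD.domNetExp_highEdge hd hm]; omega⟩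
    · obtain ⟨q, hq, -, hnet⟩ := pos_of_level hB hm hd hx (ℓ := m) (by omega) (by omega)
      refine ⟨q, hq, ?_⟩
      rw [hnet, domNetExp_interior (le_refl _) (by omega), indic_neg]
      · omega
      · intro h0; have := (hD.dpos_eq_zero_imp hd h0).2; omega
    · subst h2
      obtain ⟨q, hq, -, hnet⟩ := pos_of_level hB hm hd hx (ℓ := 2) (by omega) (by omega)
      refine ⟨q, hq, ?_⟩
      rw [hnet, domNetExp_interior (by norm_num) (by norm_num), indic_congr (two u)]
      omega

/-- a dominant class always has a pole of order `≥ 2` (`L ≤ 4` at the low edge). -/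
theorem hasPoleOfOrder_two (hB : BCell (p : ℤ) ((m - 1) * p) (b 0) (lowerB b)) (hm : 1 ≤ m)
    (hd : IsDominant (p : ℤ) (R0b p m (b 0)) (rhob p m (b 0) (lowerB b)) u) {x : ℕ}
    (hx : (p : ℤ) ∣ (x : ℤ) + 1 - tOf p m (b 0) 0 u) : HasPoleOfOrder b p x 2 := by
  have hD : DeepCell (p : ℤ) (R0b p m (b 0)) (rhob p m (b 0) (lowerB b)) := by
    rw [rhob_eq_rhoOf, R0b_eq_R0Of]; exact hB.deepCell
  obtain ⟨hL4, -, -⟩ := hD.LRnn_le_four hd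
  exact (hasPoleOfOrder_iff_of_dominant hB hm hd hx 2).2 (Or.inl (by push_cast; omega))

/-- **`H(s)` FAILS ON EVERY DEEP CELL for `s ≤ 4m + 3`** (so for `W`, `s = 3`, and `U`, `s = 5`, at every octave): a
dominant class exists, has `m + 1 ≥ 2` poles and `s + E_x ≤ s + 4 − (4m + 8) ≤ −1`.  Theorem C's hypothesis
`GoodClasses` is never met on the D region; the floor inequalities (T1-iii)/(T1-v) are the operative statements there. -/
theorem not_goodClasses_of_deep (hB : BCell (p : ℤ) ((m - 1) * p) (b 0) (lowerB b)) (hm : 1 ≤ m) {s : ℕ}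
    (hs : (s : ℤ) ≤ 4 * m + 3) : ¬ GoodClasses b p s := by
  have hD : DeepCell (p : ℤ) (R0b p m (b 0)) (rhob p m (b 0) (lowerB b)) := by
    rw [rhob_eq_rhoOf, R0b_eq_R0Of]; exact hB.deepCell
  have h := hD.levelBox
  have hp1 : (1 : ℤ) ≤ p := h.one_le_p
  obtain ⟨u, hd⟩ := hD.exists_dominant
  obtain ⟨x, hxp, hx⟩ := exists_residue_lt (m := m) (b0 := b 0) hp1 u
  intro hG
  have h1 := hG x (by exact_mod_cast hxp) (by have := classPoleCount_of_dominant hB hm hd hx; omega)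
  rw [classExp_eq h hm hB.odd_p hd.1.2.2 hd.1.1 hd.1.2.1 hx] at h1
  have h4 := le_trans (hd.2 _ hD.utStar_isClass) hD.score_utStar_le_four
  have : scoreA (p : ℤ) (R0b p m (b 0)) (rhob p m (b 0) (lowerB b)) u ≤
      score (p : ℤ) (R0b p m (b 0)) (rhob p m (b 0) (lowerB b)) u := by
    unfold scoreA score
    linarith [DeepCell.deltaA_le_delta (p : ℤ) (R0b p m (b 0)) (rhob p m (b 0) (lowerB b)) u]
  linarith

end Tree

end Config

end Summit.KontsevichZagierPeriods.Zeta5Search.DenomLaw.ThresholdModel.Rho
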